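import Summits.QuantumFields.YangMills.Theses.ParabolicTrajectory

/-!
# Triage r1-3, card `af-repeller-ir-rigidity`: the proved lever is vacuous

`NoReturnToFreePoint` (SketchIdeator1) concludes `¬ Tendsto (F^[i] p) (𝓝 (0,0))` under the hypothesis
that the orbit stays forever in the `ρ`-neighbourhood with positive coupling. We show that hypothesis is
UNSATISFIABLE for every instance of `BalabanBanachStep` (with the card's own `ρ = min δ (b/(4C))`):
the coupling gains at least `(b/2) g₀³` per step and must leave `[0, ρ]`. So the "chart half" of the
card carries no information about infrared limits (which live outside the chart).
-/

open Literature.MathematicalPhysics.QuantumFieldTheory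

noncomputable section

namespace Summit.QuantumFields.YangMills.Cruxes.LatticeGapOnTrajectory.Triage3

variable {G : Type} [Group G] [TopologicalSpace G] [IsTopologicalGroup G] [CompactSpace G]
  [MeasurableSpace G] [BorelSpace G] {r : LatticeRep G} {M : ℕ}

/-- Quantitative repeller: in the `ρ`-neighbourhood, `ρ = min δ (b/(4C))`, one step gains at least
`(b/2) g³` in the coupling. -/
theorem step_gain (S : BalabanBanachStep G r M) {g : ℝ} {y : S.E} (hg : 0 ≤ g)
    (hgρ : g ≤ min S.δ (S.b / (4 * S.C))) (hyρ : ‖y‖ ≤ min S.δ (S.b / (4 * S.C))) :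
    g + S.b / 2 * g ^ 3 ≤ S.φ g y := by
  have hb := S.b_pos
  have hC := S.C_pos
  have hgδ : g ≤ S.δ := hgρ.trans (min_le_left _ _)
  have hyδ : ‖y‖ ≤ S.δ := hyρ.trans (min_le_left _ _)
  have hgb : g ≤ S.b / (4 * S.C) := hgρ.trans (min_le_right _ _)
  have hyb : ‖y‖ ≤ S.b / (4 * S.C) := hyρ.trans (min_le_right _ _)
  have habs : |g| = g := abs_of_nonneg hg
  have hrem := (S.remainder g y (by rw [habs]; exact hgδ) hyδ).1
  rw [habs] at hrem
  have hlow : g + S.b * g ^ 3 - S.C * (g ^ 4 + g ^ 3 * ‖y‖) ≤ S.φ g y := by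
    have := (abs_le.1 hrem).1; linarith
  have hCg : S.C * g ≤ S.b / 4 := by
    calc S.C * g ≤ S.C * (S.b / (4 * S.C)) := mul_le_mul_of_nonneg_left hgb hC.le
      _ = S.b / 4 := by field_simp
  have hCy : S.C * ‖y‖ ≤ S.b / 4 := by
    calc S.C * ‖y‖ ≤ S.C * (S.b / (4 * S.C)) := mul_le_mul_of_nonneg_left hyb hC.le
      _ = S.b / 4 := by field_simp
  have hg3 : 0 ≤ g ^ 3 := by positivity
  have key : S.C * (g ^ 4 + g ^ 3 * ‖y‖) ≤ (S.b / 2) * g ^ 3 := by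
    have h1 : S.C * (g ^ 4 + g ^ 3 * ‖y‖) = (S.C * g + S.C * ‖y‖) * g ^ 3 := by ring
    rw [h1]
    exact mul_le_mul_of_nonneg_right (by linarith) hg3
  linarith

/-- Linear escape: along an orbit that stays in the `ρ`-neighbourhood with positive coupling for the
first `i` steps, the coupling at step `i` is at least `g₀ + i · (b/2) g₀³`. -/
theorem coupling_ge_linear (S : BalabanBanachStep G r M) (p : ℝ × S.E) (hp : 0 < p.1) (i : ℕ)
    (horb : ∀ j ≤ i, (S.F^[j] p).1 ∈ Set.Ioc 0 (min S.δ (S.b / (4 * S.C))) ∧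
      ‖(S.F^[j] p).2‖ ≤ min S.δ (S.b / (4 * S.C))) :
    p.1 + i * (S.b / 2 * p.1 ^ 3) ≤ (S.F^[i] p).1 ∧ p.1 ≤ (S.F^[i] p).1 := by
  induction i with
  | zero => simp
  | succ i ih =>
    have ih' := ih (fun j hj => horb j (hj.trans (Nat.le_succ i)))
    have hi := horb i (Nat.le_succ i)
    have hgain : (S.F^[i] p).1 + S.b / 2 * (S.F^[i] p).1 ^ 3 ≤ (S.F^[i + 1] p).1 := by
      rw [Function.iterate_succ_apply']
      exact step_gain S hi.1.1.le hi.1.2 hi.2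
    have hcube : p.1 ^ 3 ≤ (S.F^[i] p).1 ^ 3 := by
      have h0 : 0 ≤ p.1 := hp.le
      have h1 : p.1 ≤ (S.F^[i] p).1 := ih'.2
      gcongr
    have hb := S.b_pos
    have hb2 : 0 ≤ S.b / 2 := by positivity
    have := mul_le_mul_of_nonneg_left hcube hb2
    constructor
    · push_cast
      nlinarith [ih'.1]
    · have h3 : 0 ≤ S.b / 2 * (S.F^[i] p).1 ^ 3 := by
        have := hi.1.1.le; positivity
      linarith [ih'.2]

/-- **The hypothesis of `NoReturnToFreePoint` is unsatisfiable.** For every instance `S` there is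
`ρ > 0` (the card's `ρ = min δ (b/(4C))`) such that NO orbit with positive initial coupling stays in
the `ρ`-neighbourhood of the free point for all times. Consequently the card's corollary is vacuously
true and excludes nothing about infrared limits. -/
theorem no_orbit_stays (S : BalabanBanachStep G r M) :
    ∃ ρ : ℝ, 0 < ρ ∧ ∀ p : ℝ × S.E, 0 < p.1 →
      ¬ (∀ i : ℕ, (S.F^[i] p).1 ∈ Set.Ioc 0 ρ ∧ ‖(S.F^[i] p).2‖ ≤ ρ) := by
  have hb := S.b_pos
  have hC := S.C_pos
  refine ⟨min S.δ (S.b / (4 * S.C)), lt_min S.δ_pos (by positivity), ?_⟩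
  intro p hp horb
  have hgain : 0 < S.b / 2 * p.1 ^ 3 := by positivity
  obtain ⟨i, hi⟩ := exists_nat_gt ((min S.δ (S.b / (4 * S.C)) - p.1) / (S.b / 2 * p.1 ^ 3))
  have h1 := (coupling_ge_linear S p hp i (fun j _ => horb j)).1
  have h2 : (S.F^[i] p).1 ≤ min S.δ (S.b / (4 * S.C)) := (horb i).1.2
  have h3 : min S.δ (S.b / (4 * S.C)) - p.1 < i * (S.b / 2 * p.1 ^ 3) := by
    rwa [div_lt_iff₀ hgain] at hi
  linarith

/-- The same with ANY smaller radius: staying in a `ρ'`-neighbourhood, `ρ' ≤ ρ`, is impossible too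
(so the `∃ ρ` of `NoReturnToFreePoint` cannot be rescued by shrinking). -/
theorem no_orbit_stays_of_le (S : BalabanBanachStep G r M) {ρ' : ℝ}
    (hρ' : ρ' ≤ min S.δ (S.b / (4 * S.C))) (p : ℝ × S.E) (hp : 0 < p.1) :
    ¬ (∀ i : ℕ, (S.F^[i] p).1 ∈ Set.Ioc 0 ρ' ∧ ‖(S.F^[i] p).2‖ ≤ ρ') := by
  intro horb
  have hb := S.b_pos
  have hC := S.C_pos
  have horb' : ∀ i : ℕ, (S.F^[i] p).1 ∈ Set.Ioc 0 (min S.δ (S.b / (4 * S.C))) ∧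
      ‖(S.F^[i] p).2‖ ≤ min S.δ (S.b / (4 * S.C)) :=
    fun i => ⟨⟨(horb i).1.1, (horb i).1.2.trans hρ'⟩, (horb i).2.trans hρ'⟩
  have hgain : 0 < S.b / 2 * p.1 ^ 3 := by positivity
  obtain ⟨i, hi⟩ := exists_nat_gt ((ρ' - p.1) / (S.b / 2 * p.1 ^ 3))
  have h1 := (coupling_ge_linear S p hp i (fun j _ => horb' j)).1
  have h2 : (S.F^[i] p).1 ≤ ρ' := (horb i).1.2
  have h3 : ρ' - p.1 < i * (S.b / 2 * p.1 ^ 3) := by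
    rwa [div_lt_iff₀ hgain] at hi
  linarith

end Summit.QuantumFields.YangMills.Cruxes.LatticeGapOnTrajectory.Triage3

end
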